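import Literature.Probability.MarkovChains.TreeSumSpectral
import Literature.Probability.MarkovChains.AbsorbingChainForestFormulas
import HarnessLib

/-!
# The multiplicity of the eigenvalue `1` of a stochastic matrix through spanning forests
# (Chebotarev–Agaev 2002, Corollary 1 for `L = I − P`)

Lane `lit-hodgefound`, seat p23, generation 47, row g47-#10 of the programme «Tree and forest formulas
for finite Markov chains». HONEST FRAMING: finite state space, matrices only; «irreducible» is the tree's
`IsIrreducible` (`∀ x y, ∃ n, 0 < (P^n) x y`).

## Source, verbatim ([ChebotarevAgaev2002], held text `paper:arxiv-math_0508178`)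

§2 p. 4: «The notion of maximum in-forest of a digraph generalizes the concept of spanning converging tree
(in-arborescence). If spanning converging trees of a digraph exist, they coincide with maximum
in-forests […] every maximum in-forest of `Γ` has the minimum possible number of converging trees; we
call this number the in-forest dimension of `Γ` and denoted it by `d`.» §3 p. 6: «**Corollary 1.** The
multiplicity of `0` as the eigenvalue of `L` is `d`.» §5 p. 12: «for every finite homogeneous Markov chain
with a transition matrix `P` […] `I − P` is exactly the Laplacian matrix `L` of the weighted digraph without
loops whose arc weights are equal to the corresponding transition probabilities.»

## What is here

* `rootMultiplicity_one_charpoly_eq` — over any field, the multiplicity of `1` as a root of `χ_M` is the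
  multiplicity of `0` as a root of `χ_{I−M}` (`χ_{−A}(t) ↔ χ_A(−t)` from the tree, and Mathlib's
  `charpoly_sub_scalar`, `rootMultiplicity_comp_C_mul_X_add_C`);
* `rootMultiplicity_one_charpoly_pos` — `1` is an eigenvalue of every matrix with unit row sums;
* **`rootMultiplicity_one_charpoly_eq_forestDim`** — Corollary 1 for `L = I − P`, `P ≥ 0` with unit row
  sums: the algebraic multiplicity of the eigenvalue `1` of `P` is the in-forest dimension `d` of the
  digraph of positive transition probabilities (the least number of trees of a spanning in-forest along
  arcs `v → τ v` with `P v (τ v) > 0`; witness + minimality form, no new definition), from the tree's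
  `ChebotarevAgaev2002_cor_1`;
* **`rootMultiplicity_one_charpoly_of_irreducible`** — for an irreducible stochastic `P` a positive
  spanning tree exists (`forestWeight_pos`), so `d = 1`: **`1` is an algebraically simple eigenvalue**.
  (The tree's `PerronFrobeniusIrreducibleProofs` reaches simplicity of the Perron root of an irreducible
  non-negative matrix through Perron–Frobenius theory; this is the forest route for stochastic `P`.)

* §3 (appended, row g47-#11): **`rootMultiplicity_one_charpoly_absorbing`** — for an absorbing chain
  in Kemeny–Snell canonical form `P = [[Q, R], [0, I]]` (`IsAbsorbingBlock Q`, `R ≥ 0`, unit row sums) the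
  algebraic multiplicity of the eigenvalue `1` is the number of absorbing states: the in-forest dimension
  is `|𝔄|` (every positive spanning in-forest is rooted at all absorbing states, `absorbing_subset_roots`,
  and `det(I − Q) = w(𝔄) ≠ 0` provides one rooted exactly at `𝔄`, the tree's
  `forestWeight_absorbing_ne_zero`).

THEOREMS ONLY (no definition, no named fact, no instance).

## References

* [ChebotarevAgaev2002] §2 (in-forest dimension), §3 Corollary 1, §5 (`L = I − P`).
* [KemenySnell1976] §3.1 (canonical form of an absorbing chain; tree `AbsorbingChainFundamentalMatrix`,
  `AbsorbingChainForestFormulas`).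
* Tree: `Combinatorics/Enumerative/LaplacianCharpolyForestExpansion` (`ChebotarevAgaev2002_cor_1`),
  `Probability/MarkovChains/GreenTreeFormula` (`forestWeight_pos`, `wLaplacian_eq_one_sub`),
  `LinearAlgebra/Matrix/SpectrumSignSymmetryLeftEigenvectors` (`rootMultiplicity_charpoly_neg`).
-/

namespace Literature.Probability.MarkovChains

open Finset Matrix Polynomial Literature.Combinatorics.Enumerative
  Literature.Combinatorics.SimpleGraph.WeightedMatrixForest
open Literature.LinearAlgebra.Matrix.SpectrumSignSymmetryLeftEigenvectors (rootMultiplicity_charpoly_neg)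

variable {X : Type*} [Fintype X] [DecidableEq X]

/-! ### §1 `mult_1(χ_M) = mult_0(χ_{I−M})` -/

section AnyField

variable {K : Type*} [Field K] {n : Type*} [Fintype n] [DecidableEq n]

/-- The multiplicity of `1` as a root of `χ_M` equals the multiplicity of `0` as a root of `χ_{I−M}`
(`I − M = −(M − I)`, `χ_{−A}(t) = ±χ_A(−t)`, `χ_{M−I}(X) = χ_M(X + 1)`). [cite: ChebotarevAgaev2002, §5
(«`I − P` is exactly the Laplacian matrix `L`»: the eigenvalue `1` of `P` is the eigenvalue `0` of `L`)] -/
theorem rootMultiplicity_one_charpoly_eq (M : Matrix n n K) :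
    M.charpoly.rootMultiplicity 1 = ((1 : Matrix n n K) - M).charpoly.rootMultiplicity 0 := by
  have hM : (1 : Matrix n n K) - M = -(M - Matrix.scalar n 1) := by
    rw [map_one, neg_sub]
  have hlin : Polynomial.X + C (1 : K) = C 1 * Polynomial.X + C 1 := by
    rw [map_one, one_mul]
  rw [hM, rootMultiplicity_charpoly_neg, neg_zero, Matrix.charpoly_sub_scalar, hlin,
    rootMultiplicity_comp_C_mul_X_add_C _ _ _ _ isUnit_one, mul_zero, zero_add]

/-- `1` is an eigenvalue of every matrix with unit row sums: `mult_1(χ_Q) ≥ 1` (`det(I − Q) = 0`).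
[cite: ChebotarevAgaev2002, §3 (proof of Corollary 1: `σ_n = det L = 0`, `0` is an eigenvalue of `L`)] -/
theorem rootMultiplicity_one_charpoly_pos [Nonempty n] {Q : Matrix n n K} (hQ : ∀ x, ∑ y, Q x y = 1) :
    0 < Q.charpoly.rootMultiplicity 1 := by
  rw [rootMultiplicity_one_charpoly_eq, rootMultiplicity_pos (Matrix.charpoly_monic _).ne_zero, IsRoot,
    ← coeff_zero_eq_eval_zero]
  have h := Matrix.det_eq_sign_charpoly_coeff ((1 : Matrix n n K) - Q)
  rw [← wLaplacian_eq_one_sub' hQ, det_wLaplacian] at h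
  rw [← wLaplacian_eq_one_sub' hQ]
  exact ((isUnit_one.neg).pow _).mul_right_eq_zero.1 h.symm

end AnyField

/-! ### §2 Corollary 1 for `L = I − P`: the multiplicity of the eigenvalue `1` is the in-forest dimension -/

section Stochastic

variable {P : Matrix X X ℝ}

/-- **Corollary 1 for a stochastic matrix: the algebraic multiplicity of the eigenvalue `1` of `P` (`P ≥ 0`,
unit row sums) equals the in-forest dimension `d`** of the digraph of positive transition probabilities —
the least number of trees (roots) of a spanning in-forest `τ` with `P v (τ v) > 0` along every arc (given
by a witness with `d` roots and minimality). [cite: ChebotarevAgaev2002, §3 Corollary 1 with §5 («`I − P`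
is exactly the Laplacian matrix `L` of the weighted digraph without loops whose arc weights are equal to
the corresponding transition probabilities»)] -/
theorem rootMultiplicity_one_charpoly_eq_forestDim (hP0 : ∀ x y, 0 ≤ P x y) (hP1 : ∀ x, ∑ y, P x y = 1)
    {d : ℕ}
    (hex : ∃ (R : Finset X) (τ : X → X), R.card = d ∧ IsForestOn (univ : Finset X) R τ ∧
      ∀ v ∉ R, 0 < P v (τ v))
    (hmin : ∀ (R : Finset X) (τ : X → X), IsForestOn (univ : Finset X) R τ →
      (∀ v ∉ R, 0 < P v (τ v)) → d ≤ R.card) :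
    P.charpoly.rootMultiplicity 1 = d := by
  rw [rootMultiplicity_one_charpoly_eq, ← wLaplacian_eq_one_sub hP1]
  exact ChebotarevAgaev2002_cor_1 (fun x y => P x y) hP0 hex hmin

/-- A spanning in-forest on a nonempty vertex set has at least one root. [cite: ChebotarevAgaev2002, §2
(«the number of disjoint trees in a spanning forest with `k` arcs is `n − k`», `k ≤ n − d`, `d ≥ 1`)] -/
theorem _root_.Literature.Combinatorics.Enumerative.IsForestOn.card_roots_pos [Nonempty X] {R : Finset X} {τ : X → X}
    (hτ : IsForestOn (univ : Finset X) R τ) : 0 < R.card := by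
  obtain ⟨m, hm⟩ := (isForestOn_univ_iff.1 hτ).2 (Classical.arbitrary X)
  exact Finset.card_pos.2 ⟨_, hm⟩

/-- **For an irreducible stochastic matrix, `1` is an algebraically simple eigenvalue** — the forest route:
irreducibility gives a spanning in-tree of positive weight towards any state (`forestWeight_pos`), so the
in-forest dimension is `d = 1` («if spanning converging trees of a digraph exist, they coincide with
maximum in-forests»), and Corollary 1 gives multiplicity `1`. [cite: ChebotarevAgaev2002, §3 Corollary 1
with §2 («If spanning converging trees of a digraph exist, they coincide with maximum in-forests»)] -/
theorem rootMultiplicity_one_charpoly_of_irreducible [Nonempty X] (hP : IsRowStochastic P)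
    (hirr : IsIrreducible P) : P.charpoly.rootMultiplicity 1 = 1 := by
  obtain ⟨r⟩ := ‹Nonempty X›
  have hw : forestWeight (fun x y => P x y) {r} ≠ 0 :=
    (forestWeight_pos hP hirr (singleton_nonempty r)).ne'
  obtain ⟨τ, hτ, hne⟩ := exists_isForestOn_of_forestWeight_ne_zero hw
  exact rootMultiplicity_one_charpoly_eq_forestDim hP.1 hP.2
    ⟨{r}, τ, card_singleton r, hτ, fun v hv => lt_of_le_of_ne (hP.1 _ _) (hne v hv).symm⟩
    fun R τ' hτ' _ => hτ'.card_roots_pos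

end Stochastic

/-! ### §3 Absorbing chains: the multiplicity of the eigenvalue `1` is the number of absorbing states -/

section Absorbing

variable {T A : Type*} [Fintype T] [DecidableEq T] [Fintype A] [DecidableEq A]
  {Q : Matrix T T ℝ} {R : Matrix T A ℝ}

omit [Fintype T] [DecidableEq T] [Fintype A] in
/-- The canonical matrix `[[Q, R], [0, I]]` is entrywise non-negative when `Q, R ≥ 0`.
[cite: KemenySnell1976, §3.1 (canonical form `P = [[Q, R], [0, I]]` of an absorbing chain)] -/
theorem fromBlocks_canonical_nonneg (hQ : ∀ i j, 0 ≤ Q i j) (hR : ∀ i a, 0 ≤ R i a)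
    (x y : T ⊕ A) : 0 ≤ Matrix.fromBlocks Q R 0 (1 : Matrix A A ℝ) x y := by
  rcases x with i | a <;> rcases y with j | b
  · rw [fromBlocks_apply₁₁]; exact hQ i j
  · rw [fromBlocks_apply₁₂]; exact hR i b
  · rw [fromBlocks_apply₂₁]; exact le_rfl
  · rw [fromBlocks_apply₂₂, Matrix.one_apply]; split_ifs <;> norm_num

/-- In the canonical chain every spanning in-forest with positive transition probabilities along its
arcs is rooted at ALL the absorbing states (an absorbing state has no positive arc out).
[cite: KemenySnell1976, §3.1 («absorbing states», `p_{ii} = 1`)] [cite: ChebotarevAgaev2002, §2 (maximum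
in-forests)] -/
theorem absorbing_subset_roots {R' : Finset (T ⊕ A)} {τ : T ⊕ A → T ⊕ A}
    (hτ : IsForestOn (univ : Finset (T ⊕ A)) R' τ)
    (hpos : ∀ v ∉ R', 0 < Matrix.fromBlocks Q R 0 (1 : Matrix A A ℝ) v (τ v)) :
    (univ : Finset A).map Function.Embedding.inr ⊆ R' := by
  intro v hv
  rw [Finset.mem_map] at hv
  obtain ⟨a, -, hav⟩ := hv
  rw [Function.Embedding.inr_apply] at hav
  subst hav
  by_contra ha
  have hne := hτ.apply_ne_self ha
  have hp := hpos _ ha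
  rcases hy : τ (Sum.inr a) with j | b
  · rw [hy, fromBlocks_apply₂₁, Matrix.zero_apply] at hp
    exact lt_irrefl _ hp
  · rw [hy] at hne hp
    rw [fromBlocks_apply₂₂, Matrix.one_apply_ne fun h => hne (by rw [h])] at hp
    exact lt_irrefl _ hp

/-- **For an absorbing chain in canonical form `P = [[Q, R], [0, I]]` the algebraic multiplicity of the
eigenvalue `1` of `P` is the number of absorbing states** — Corollary 1 with in-forest dimension
`d = |𝔄|`: `det(I − Q) = w(𝔄) ≠ 0` gives a positive spanning in-forest rooted exactly at the absorbing
states, and every positive spanning in-forest is rooted at all of them. [cite: ChebotarevAgaev2002, §3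
Corollary 1] [cite: KemenySnell1976, §3.1 (canonical form; `I − Q` invertible, Thm 3.2.1)] -/
theorem rootMultiplicity_one_charpoly_absorbing (h : IsAbsorbingBlock Q) (hR : ∀ i a, 0 ≤ R i a)
    (hrow : ∀ i, ∑ a, R i a + ∑ j, Q i j = 1) :
    (Matrix.fromBlocks Q R 0 (1 : Matrix A A ℝ)).charpoly.rootMultiplicity 1 = Fintype.card A := by
  obtain ⟨τ, hτ, hne⟩ := exists_isForestOn_of_forestWeight_ne_zero (forestWeight_absorbing_ne_zero h hrow)
  have hp0 := fromBlocks_canonical_nonneg h.nonneg hR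
  refine rootMultiplicity_one_charpoly_eq_forestDim hp0 (fromBlocks_rowsum hrow)
    ⟨(univ : Finset A).map Function.Embedding.inr, τ, by rw [card_map, card_univ], hτ,
      fun v hv => lt_of_le_of_ne (hp0 _ _) (hne v hv).symm⟩
    fun R' τ' hτ' hpos' => ?_
  calc Fintype.card A = ((univ : Finset A).map Function.Embedding.inr).card := by rw [card_map, card_univ]
    _ ≤ R'.card := card_le_card (absorbing_subset_roots hτ' hpos')

end Absorbing

end Literature.Probability.MarkovChains
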